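import Summits.QuantumFields.BalabanUV.Beta.D1BFx.PackedResponseTorus
import Summits.QuantumFields.BalabanUV.Beta.D1BFx.PeriodicArrayBiSuperpositionTorus
import Summits.QuantumFields.BalabanUV.Beta.D1BFx.SortedKKTShape
import Summits.QuantumFields.BalabanUV.Beta.D1BFx.PackedStructuralSockets

/-!
# `BalabanUV.Beta.D1BFx.PackedDictionaryLetters` — road «BF-x» for binder row D1, slot (K), chain step (I) «(A1)-PACKED», brick (B3) PART 1
# «A1-PACKED-TORUS — DICTIONARY AND PARITY LETTERS» (`A1-PACKED-SPEC.md` v0.4 §8∕§9): **ON EVERY COARSE TORUS, FOR RESPONSE-PACKED DATA, THE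
# (A2-M) DICTIONARY LETTERS `hJM hJM′ hJM″` AND THE PARITY LETTERS `hkₛ hkₜ hkₛₜ` OF `KCombineCovColourTorus.identity_array_currency_cov_What0_stripped`
# ARE THEOREMS** — the response-packed sums of the per-bond torus tables (responses = columns of the torus comb-gauged KKT inverse `M_T⁻¹`, (B4b))
# ARE the periodised sorted arrays of the road's packed `ℤ^D` tables ((B4c), (B4e)), which ARE `kkt`-shaped with the parity of the single-bond stencils
# («KKT-SHAPE» + «SOCKET-PASS»).

HONEST DEPENDENCY (cell records, verbatim): «continuum YM on T⁴ ⇐ BetaPertH ∧ nine spine estimates (0/9 proved); BetaPertH ⇐ (D1) ∧ (D4) ∧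
CAP+tail; G-an2-4 gates asym, D1 and NE2/3/4.»  HONEST FRAMING (cell contract, verbatim): «discharging `BetaPertH` makes Bałaban's UV stability
UNCONDITIONAL — a real constructive-QFT result; it is NOT the continuum limit and NOT the Clay problem.»  THIS MODULE DISCHARGES NOTHING of (K),
of D1 or of the wall: [folklore] composition BY NAME of (B4b) `PackedResponseTorus.response_inl_eq_tsum_colH_window`, (B4c)
`PeriodicArraySuperpositionTorus.blocksHat_sortK_arr_vertexOfK`, (B4e) `PeriodicArrayBiSuperpositionTorus.blocksHat_sortK_arr_packed₂_dir`,
`SortedKKTShape` and `PackedStructuralSockets`, over `AxialDressingRootedBmHessian.decays_coDressKBmAt_KInvStep`.  The STRUCTURAL SOCKETS of the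
literal's stencils (no mm block, fm∕mf kernel (anti)symmetry, ff kernel (anti)symmetry, localisation, covariance) are DISPLAYED hypotheses; the
«WRAP-UNIFORM» socket is gan24-leaf-05's `PeriodicArrayWrapUniform.biLoc_wsum_images` BY NAME; nothing of Bałaban's is asserted.  No definition, no `def … : Prop`, nothing cited, 0 sorry.  0 root-level binders of row
D1 discharged; (K) NOT closed; NOT D1, NOT `BetaPertH`, NOT continuum, NOT Clay.

ABSOLUTE RULE (cell charter, verbatim): «No internally-minted statement may enter as a cited fact. Every hypothesis is either kernel-proved in this
package or a verbatim quotation of a PUBLISHED theorem with page reference. The manuscript(s) under audit are NOT citable for their own disputed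
steps — they are the thing under adjudication; programme-internal (2001/route/tribunal) claims are never citable.»

CONTENT (torus `n, p`, root `r ∈ box (d+1) n`, `s = n·p`, `G₀ := coDressKBmAt (toSite r) n (KInvStep n 0)`, `M_T := kkt K̂ (fromRows Q̂ τ_T)`,
responses `r_{(ȳ,μ)} k := M_T⁻¹ (inl k) (inr (inl (ȳ, μ)))`, `ŵ_k := windowMap (n·p) (torusBlockEquiv n p (k.1, k.2.1))`, `κ′_k := k.2.2`).
* §1 `locStencil_mono`, `body_mono` (rate bookkeeping), **`packed_first_letter`**: `(arr s (vertexOfK G₀ n S μ ŷ))ˆ = Σ_k r_{(ȳ,μ)} k • (arr s (S κ′_k ŵ_k))ˆ`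
  (`hJM`, `hJM′` for packed data: (B4c) + (B4b)).
* §2 **`packed_first_kkt`** (`(arr s (vertexOfK G₀ n S μ ŷ))ˆ = kkt ff̂ m̂f` from «no mm block» + «fm = transposed mf» of `S`), **`packed_first_parity`** (`(ff̂)ᵀ = −ff̂`
  from ff antisymmetry of `S`) — the letters `hkₛ hkₜ`.
* §3 **`packed_second_letter`**: `(arr s 𝒲^{(s)})ˆ = Σ_{k,l} r_{(ȳ₀,μ)} k · r_{(ȳ_z,ν)} l • (Σ'_t arr s (S₂ κ′_k ŵ_k κ′_l (ŵ_l + s·t)))ˆ` under the `LocStencil₂` body, joint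
  period covariance ((B4e) + (B4b); (B4e)'s «WRAP-UNIFORM» socket discharged by `PeriodicArrayWrapUniform.biLoc_wsum_images`) — the letter `hJM″`'s right-hand side
  at the p-dependent table of F-g16-1.
* §4 **`packed_second_kkt_sgn`** (`(arr s 𝒲^{(s)})ˆ = kkt ff̂ m̂f · diag(1,−1)` from «no mm block» + «fm = −transposed mf» of `S₂`), **`packed_second_parity`**
  (`(ff̂)ᵀ = ff̂` from ff symmetry of `S₂`) — the letter `hkₛₜ` and the F-g6-1 placement.
Unit `b2b-balaban-beta-d1-p2` (road owner, gen 17), 2026-08-22.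
-/

noncomputable section

namespace Summit.QuantumFields.BalabanUV.Beta.D1BFx.PackedDictionaryLetters

open Matrix
open scoped BigOperators
open Literature.Probability.LatticeModels (TorusSite)
open Literature.MathematicalPhysics.QuantumFieldTheory.Balaban1983to89
open Literature.MathematicalPhysics.QuantumFieldTheory.Balaban1983to89.Beta
open Literature.MathematicalPhysics.QuantumFieldTheory.Balaban1983to89.Beta.Composition (kkt)
open B12Sec2to5 (l1 l1_nonneg)
open ExpKernelCalculus (MKer BiLoc Decays shiftK Zl)
open AffineAveraging (box toSite)
open OneStepResolventKernel (Fib wsum LocStencil biLoc_mono bound_mono)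
open OneStepKernelFamily (KInvStep colH vertexOfK abs_colH_le)
open Summit.QuantumFields.BalabanUV.Beta.AxialDressingRooted (coDressKBmAt decays_coDressKBmAt_KInvStep)
open Summit.QuantumFields.BalabanUV.Beta.D1BFx.FibredPeriodisation (periodiseF Kfib)
open Summit.QuantumFields.BalabanUV.Beta.D1BFx.SortedKernels (blocksHat fTL fBL)
open Summit.QuantumFields.BalabanUV.Beta.D1BFx.SortedReblocking (torusBlockEquiv)
open Summit.QuantumFields.BalabanUV.Beta.D1BFx.SortedPack (sortK)
open Summit.QuantumFields.BalabanUV.Beta.D1BFx.TorusCombKKT (I J CombRows tauT Khat Qhat)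
open Summit.QuantumFields.BalabanUV.Beta.D1BFx.PeriodicArrays (arr)
open Summit.QuantumFields.BalabanUV.Beta.D1BFx.PackedResponseTorus (response_inl_eq_tsum_colH_window)
open Summit.QuantumFields.BalabanUV.Beta.D1BFx.PeriodicArraySuperpositionTorus (blocksHat_sortK_arr_vertexOfK)
open Summit.QuantumFields.BalabanUV.Beta.D1BFx.PeriodicArrayBiSuperpositionTorus (blocksHat_sortK_arr_packed₂_dir)
open Summit.QuantumFields.BalabanUV.Beta.D1BFx.PeriodicArrayWrapUniform (biLoc_wsum_images)
open Summit.QuantumFields.BalabanUV.Beta.D1BFx.SortedKKTShape (isPeriodic₂_sortK_arr blocksHat_sortK_eq_kkt blocksHat_sortK_eq_kkt_mul_sgn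
  transpose_ffHat_eq transpose_ffHat_eq_neg)
open Summit.QuantumFields.BalabanUV.Beta.D1BFx.PackedStructuralSockets (arr_vertexOfK_inr_inr arr_vertexOfK_inl_inr arr_vertexOfK_inl_inl
  arr_packed₂_inr_inr arr_packed₂_inl_inr arr_packed₂_inl_inl)

variable {d : ℕ}

/-! ## §1 The first-order dictionary letter at the torus responses -/

section First

/-- [folklore] A self-localised stencil family stays self-localised at any smaller rate (same constant). -/
theorem locStencil_mono {S : Fin (d + 1) → (Fin (d + 1) → ℤ) → MKer (d + 1) (Fib d)} {Cs δ δ' : ℝ} (hS : LocStencil S Cs δ) (hCs : 0 ≤ Cs)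
    (hδ' : δ' ≤ δ) : LocStencil S Cs δ' :=
  fun κ' u => biLoc_mono (hS κ' u) hCs hδ'

variable {n : ℕ} [NeZero n] {r : Fin (d + 1) → ℕ} (hr : r ∈ box (d + 1) n) (p : ℕ) [NeZero p]
include hr

/-- [folklore] **(B3) PART 1, FIRST ORDER — THE DICTIONARY LETTER `hJM` FOR RESPONSE-PACKED DATA IS A THEOREM.**  For a self-localised (`LocStencil S Cs δ`,
`δ > 0`), fine-translation-covariant stencil family `S`, on every coarse torus (`n`, `p`, root `r ∈ box`), at every coarse bond `(ȳ, μ)`: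
`(arr (n·p) (vertexOfK G₀ n S μ ŷ))ˆ = Σ_{k : I d n p} M_T⁻¹ (inl k) (inr (inl (ȳ, μ))) • (arr (n·p) (S κ′_k ŵ_k))ˆ`, `ŷ = windowMap p ȳ` — the RESPONSE-PACKED sum of the
per-bond torus tables, with the responses THE COLUMNS OF THE TORUS COMB-GAUGED KKT INVERSE, IS the periodised sorted array of the road's packed first jet
through `G₀` ((B4c) `blocksHat_sortK_arr_vertexOfK` + (B4b) `response_inl_eq_tsum_colH_window`; rates met at `min δ δ_G`). -/
theorem packed_first_letter {S : Fin (d + 1) → (Fin (d + 1) → ℤ) → MKer (d + 1) (Fib d)} {Cs δ : ℝ} (hS : LocStencil S Cs δ) (hCs : 0 ≤ Cs)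
    (hδ : 0 < δ) (hScov : ∀ κ' u v, S κ' (u + v) = shiftK (-v) (S κ' u)) (ybar : Beta.Site (d + 1) p) (μ : Fin (d + 1)) :
    blocksHat p (sortK n (arr (n * p) (vertexOfK (coDressKBmAt (toSite r) n (KInvStep (d := d) n 0)) n S μ (windowMap (d + 1) p ybar))))
      = ∑ k : I d n p,
          (kkt (Khat (d := d) n p) (Matrix.fromRows (Qhat (d := d) n p) (tauT (toSite r) n p)))⁻¹ (Sum.inl k) (Sum.inr (Sum.inl (ybar, μ)))
            • blocksHat p (sortK n (arr (n * p) (S k.2.2 (windowMap (d + 1) (n * p) (torusBlockEquiv n p (k.1, k.2.1)))))) := by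
  obtain ⟨δG, CG, hδG, hCG, hG⟩ := decays_coDressKBmAt_KInvStep (d := d) hr 0
  rw [blocksHat_sortK_arr_vertexOfK hG hCG (locStencil_mono hS hCs (min_le_left δ δG)) (lt_min hδ hδG) (min_le_right δ δG) hScov μ _]
  refine Finset.sum_congr rfl fun k _ => ?_
  obtain ⟨zbar, zhat, κ'⟩ := k
  rw [response_inl_eq_tsum_colH_window hr p ybar μ zbar zhat κ']

end First

/-! ## §2 The first-order `kkt` shape and parity from the sockets of `S` -/

section FirstShape

variable {n : ℕ} (p : ℕ) [NeZero p] (K : MKer (d + 1) (Fib d)) {S : Fin (d + 1) → (Fin (d + 1) → ℤ) → MKer (d + 1) (Fib d)}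
  (μ : Fin (d + 1)) (y : Fin (d + 1) → ℤ)

/-- [folklore] **THE PACKED FIRST JET IS `kkt`-SHAPED** (`hJM : kkt kₛ qₛ = (arr s 𝒱)ˆ` with `kₛ := ff̂`, `qₛ := m̂f`): from «no mm block» and «fm = kernel-transpose of mf»
of every single-bond stencil `S κ′ u`. -/
theorem packed_first_kkt (hmm : ∀ κ' u x z (a b : Fin (d + 1)), S κ' u x z (Sum.inr a) (Sum.inr b) = 0)
    (hfm : ∀ κ' u x z (a b : Fin (d + 1)), S κ' u x z (Sum.inl a) (Sum.inr b) = S κ' u z x (Sum.inr b) (Sum.inl a)) :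
    blocksHat p (sortK n (arr (n * p) (vertexOfK K n S μ y)))
      = kkt (Matrix.of (periodiseF p (fTL (sortK n (arr (n * p) (vertexOfK K n S μ y))))))
          (Matrix.of (periodiseF p (fBL (sortK n (arr (n * p) (vertexOfK K n S μ y)))))) := by
  refine blocksHat_sortK_eq_kkt (isPeriodic₂_sortK_arr _) (fun x z a b => arr_vertexOfK_inr_inr K n (n * p) μ y hmm x z a b)
    (fun x z a b => ?_)
  have h := arr_vertexOfK_inl_inr K n (n * p) μ y (ε := 1) (fun κ' u x z a b => by rw [one_mul]; exact hfm κ' u x z a b) x z a b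
  rwa [one_mul] at h

/-- [folklore] **THE PACKED FIRST ff BLOCK IS ANTISYMMETRIC** (`hkₛ : kₛᵀ = −kₛ`): from the ff kernel antisymmetry of every single-bond stencil. -/
theorem packed_first_parity (hff : ∀ κ' u x z (a b : Fin (d + 1)), S κ' u x z (Sum.inl a) (Sum.inl b) = -S κ' u z x (Sum.inl b) (Sum.inl a)) :
    (Matrix.of (periodiseF p (fTL (sortK n (arr (n * p) (vertexOfK K n S μ y))))))ᵀ
      = -Matrix.of (periodiseF p (fTL (sortK n (arr (n * p) (vertexOfK K n S μ y))))) := by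
  refine transpose_ffHat_eq_neg (isPeriodic₂_sortK_arr _) (fun x z a b => ?_)
  have h := arr_vertexOfK_inl_inl K n (n * p) μ y (ε := -1) (fun κ' u x z a b => by rw [neg_one_mul]; exact hff κ' u x z a b) x z a b
  rwa [neg_one_mul] at h

end FirstShape

/-! ## §3 The second-order dictionary letter at the torus responses -/

section Second

/-- [folklore] The `LocStencil₂` body at a smaller rate (both the localisation and the bond-separation factor weaken). -/
theorem body_mono {S₂ : Fin (d + 1) → (Fin (d + 1) → ℤ) → Fin (d + 1) → (Fin (d + 1) → ℤ) → MKer (d + 1) (Fib d)} {Ck δ δ' : ℝ}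
    (hS₂ : ∀ κ u κ' u', BiLoc (S₂ κ u κ' u') u u (Ck * Real.exp (-δ * l1 (u' - u))) δ) (hCk : 0 ≤ Ck) (hδ' : δ' ≤ δ) :
    ∀ κ u κ' u', BiLoc (S₂ κ u κ' u') u u (Ck * Real.exp (-δ' * l1 (u' - u))) δ' := by
  intro κ u κ' u' x y a b
  refine (hS₂ κ u κ' u' x y a b).trans ?_
  rw [mul_assoc, mul_assoc, ← Real.exp_add, ← Real.exp_add]
  refine mul_le_mul_of_nonneg_left (Real.exp_le_exp.2 ?_) hCk
  nlinarith [l1_nonneg (u' - u), l1_nonneg (x - u), l1_nonneg (y - u)]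

variable {n : ℕ} [NeZero n] {r : Fin (d + 1) → ℕ} (hr : r ∈ box (d + 1) n) (p : ℕ) [NeZero p]
include hr

/-- [folklore] **(B3) PART 1, SECOND ORDER — THE DICTIONARY LETTER `hJM″` FOR RESPONSE-PACKED DATA, AT THE p-DEPENDENT TABLE OF F-g16-1.**  For a fine
bi-stencil family `S₂` with the `LocStencil₂` body (`BiLoc (S₂ κ u λ u′) u u (Cₖ·e^{−δ|u′−u|₁}) δ`, `δ > 0`), jointly covariant under the period translates
(`s = n·p`), and (the «WRAP-UNIFORM» socket of (B4e) DISCHARGED inside, per slice, by gan24-leaf-05's `PeriodicArrayWrapUniform.biLoc_wsum_images`; the inner family written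
`wsum ω (S₂ κ′ u κ″)`, `ω u″ := Σ'_m colH G₀ n ν ŷ₁ κ″ (u″ + s·m)` — `rfl`-equal to (B4e)'s displayed lambda), on every coarse torus and at every pair of coarse bonds
`(ȳ₀, μ)`, `(ȳ₁, ν)`:
`(arr s 𝒲^{(s)})ˆ = Σ_{k l : I d n p} M_T⁻¹ (inl k) (inr (inl (ȳ₀,μ))) · M_T⁻¹ (inl l) (inr (inl (ȳ₁,ν))) • (fun x y a b => Σ'_t arr s (S₂ κ′_k ŵ_k κ′_l (ŵ_l + s·t)) x y a b)ˆ`,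
`𝒲^{(s)} := fun x y a b => Σ_{κ′} Σ_{λ′} wsum (colH G₀ n μ ŷ₀ κ′) (u ↦ Σ'_{u″} (Σ'_m colH G₀ n ν ŷ₁ λ′ (u″ + s·m)) · S₂ κ′ u λ′ u″) x y a b` — the response-packed sum of
the torus PAIR tables IS the periodised sorted array of the one-periodised double superposition ((B4e) + (B4b)). -/
theorem packed_second_letter
    {S₂ : Fin (d + 1) → (Fin (d + 1) → ℤ) → Fin (d + 1) → (Fin (d + 1) → ℤ) → MKer (d + 1) (Fib d)} {Ck δ : ℝ}
    (hS₂ : ∀ κ u κ' u', BiLoc (S₂ κ u κ' u') u u (Ck * Real.exp (-δ * l1 (u' - u))) δ) (hCk : 0 ≤ Ck) (hδ : 0 < δ)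
    (hS₂cov : ∀ κ' κ'' u u' m, S₂ κ' (imageShift (n * p) u m) κ'' (imageShift (n * p) u' m) = shiftK (-(((n * p : ℕ) : ℤ) • m)) (S₂ κ' u κ'' u'))
    (ybar₀ ybar₁ : Beta.Site (d + 1) p) (μ ν : Fin (d + 1)) :
    blocksHat p (sortK n (arr (n * p) (fun x y a b => ∑ κ' : Fin (d + 1), ∑ κ'' : Fin (d + 1),
        wsum (colH (coDressKBmAt (toSite r) n (KInvStep (d := d) n 0)) n μ (windowMap (d + 1) p ybar₀) κ')
          (fun u => wsum (fun u'' => ∑' m : Fin (d + 1) → ℤ,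
            colH (coDressKBmAt (toSite r) n (KInvStep (d := d) n 0)) n ν (windowMap (d + 1) p ybar₁) κ'' (imageShift (n * p) u'' m))
            (S₂ κ' u κ'')) x y a b)))
      = ∑ k : I d n p, ∑ l : I d n p,
          ((kkt (Khat (d := d) n p) (Matrix.fromRows (Qhat (d := d) n p) (tauT (toSite r) n p)))⁻¹ (Sum.inl k) (Sum.inr (Sum.inl (ybar₀, μ)))
            * (kkt (Khat (d := d) n p) (Matrix.fromRows (Qhat (d := d) n p) (tauT (toSite r) n p)))⁻¹ (Sum.inl l) (Sum.inr (Sum.inl (ybar₁, ν))))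
            • blocksHat p (sortK n (fun x y a b => ∑' t : Fin (d + 1) → ℤ,
                arr (n * p) (S₂ k.2.2 (windowMap (d + 1) (n * p) (torusBlockEquiv n p (k.1, k.2.1))) l.2.2
                  (imageShift (n * p) (windowMap (d + 1) (n * p) (torusBlockEquiv n p (l.1, l.2.1))) t)) x y a b)) := by
  obtain ⟨δG, CG, hδG, hCG, hG⟩ := decays_coDressKBmAt_KInvStep (d := d) hr 0
  -- common rate
  have hδ' : 0 < min δ δG := lt_min hδ hδG
  have hw : ∀ κ' u, |colH (coDressKBmAt (toSite r) n (KInvStep (d := d) n 0)) n μ (windowMap (d + 1) p ybar₀) κ' u|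
      ≤ CG * Real.exp (-(min δ δG) * l1 (u - (n : ℤ) • windowMap (d + 1) p ybar₀)) :=
    fun κ' u => bound_mono (abs_colH_le (N := n) hG μ _ κ' u) hCG le_rfl (min_le_right _ _) (l1_nonneg _)
  have hw' : ∀ κ' u, |colH (coDressKBmAt (toSite r) n (KInvStep (d := d) n 0)) n ν (windowMap (d + 1) p ybar₁) κ' u|
      ≤ CG * Real.exp (-(min δ δG) * l1 (u - (n : ℤ) • windowMap (d + 1) p ybar₁)) :=
    fun κ' u => bound_mono (abs_colH_le (N := n) hG ν _ κ' u) hCG le_rfl (min_le_right _ _) (l1_nonneg _)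
  -- (B4e), directional form (the inner family `wsum ω (S₂ κ′ u κ″)` unfolds to its displayed lambda by `rfl`)
  -- the «WRAP-UNIFORM» socket of (B4e), DISCHARGED per slice by gan24-leaf-05's `biLoc_wsum_images` (uniform constant, centre `n•ŷ₀`)
  have hWloc : ∀ κ' κ'', BiLoc (wsum (colH (coDressKBmAt (toSite r) n (KInvStep (d := d) n 0)) n μ (windowMap (d + 1) p ybar₀) κ')
      (fun u => wsum (fun u'' => ∑' m : Fin (d + 1) → ℤ,
        colH (coDressKBmAt (toSite r) n (KInvStep (d := d) n 0)) n ν (windowMap (d + 1) p ybar₁) κ'' (imageShift (n * p) u'' m)) (S₂ κ' u κ'')))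
      ((n : ℤ) • windowMap (d + 1) p ybar₀) ((n : ℤ) • windowMap (d + 1) p ybar₀)
      (CG * (CG * Ck * Zl (d + 1) (min δ δG / 2) * Zl (d + 1) (min δ δG / 2)) * Zl (d + 1) (min δ δG / 2)) (min δ δG / 2) :=
    fun κ' κ'' => biLoc_wsum_images (hw κ') (hw' κ'') (fun u u' => body_mono hS₂ hCk (min_le_left _ _) κ' u κ'' u') hδ' (n * p)
  have h := blocksHat_sortK_arr_packed₂_dir (n := n) (p := p) (S₂ := S₂)
    (P := fun _ => (n : ℤ) • windowMap (d + 1) p ybar₀) (P' := fun _ => (n : ℤ) • windowMap (d + 1) p ybar₁)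
    hw hw' (body_mono hS₂ hCk (min_le_left _ _)) hS₂cov hδ' hCG hCG hCk hWloc (half_pos hδ')
  refine Eq.trans ?_ (h.trans ?_)
  · rfl
  refine Finset.sum_congr rfl fun k _ => Finset.sum_congr rfl fun l _ => ?_
  obtain ⟨zbar, zhat, κ'⟩ := k
  obtain ⟨zbar', zhat', κ''⟩ := l
  rw [response_inl_eq_tsum_colH_window hr p ybar₀ μ zbar zhat κ', response_inl_eq_tsum_colH_window hr p ybar₁ ν zbar' zhat' κ'']

end Second

/-! ## §4 The second-order `kkt · diag(1,−1)` shape and parity from the sockets of `S₂` -/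

section SecondShape

variable {n : ℕ} [NeZero n] (p : ℕ) [NeZero p] {w w' : Fin (d + 1) → (Fin (d + 1) → ℤ) → ℝ}
  {S₂ : Fin (d + 1) → (Fin (d + 1) → ℤ) → Fin (d + 1) → (Fin (d + 1) → ℤ) → MKer (d + 1) (Fib d)}

/-- [folklore] **THE PACKED SECOND TABLE IS `kkt · diag(1,−1)`-SHAPED** (`hJM″`'s placement, F-g6-1): from «no mm block» and «fm = MINUS the
kernel-transpose of mf» of every pair stencil `S₂ κ u λ u′` (the sockets pass through both superpositions, the finite slice sums and the array). -/
theorem packed_second_kkt_sgn (hmm : ∀ κ u κ' u' x z (a b : Fin (d + 1)), S₂ κ u κ' u' x z (Sum.inr a) (Sum.inr b) = 0)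
    (hfm : ∀ κ u κ' u' x z (a b : Fin (d + 1)), S₂ κ u κ' u' x z (Sum.inl a) (Sum.inr b) = -S₂ κ u κ' u' z x (Sum.inr b) (Sum.inl a)) :
    blocksHat p (sortK n (arr (n * p) (fun x y a b => ∑ κ' : Fin (d + 1), ∑ κ'' : Fin (d + 1),
        wsum (w κ') (fun u => wsum (w' κ'') (S₂ κ' u κ'')) x y a b)))
      = kkt (Matrix.of (periodiseF p (fTL (sortK n (arr (n * p) (fun x y a b => ∑ κ' : Fin (d + 1), ∑ κ'' : Fin (d + 1),
            wsum (w κ') (fun u => wsum (w' κ'') (S₂ κ' u κ'')) x y a b))))))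
          (Matrix.of (periodiseF p (fBL (sortK n (arr (n * p) (fun x y a b => ∑ κ' : Fin (d + 1), ∑ κ'' : Fin (d + 1),
            wsum (w κ') (fun u => wsum (w' κ'') (S₂ κ' u κ'')) x y a b))))))
        * Matrix.fromBlocks (1 : Matrix (I d n p) (I d n p) ℝ) 0 0 (-1 : Matrix (J d p) (J d p) ℝ) := by
  refine blocksHat_sortK_eq_kkt_mul_sgn (isPeriodic₂_sortK_arr _) (fun x z a b => arr_packed₂_inr_inr (n * p) hmm x z a b) (fun x z a b => ?_)
  have h := arr_packed₂_inl_inr (wd := w) (ωd := w') (n * p) (ε := -1)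
    (fun κ u κ' u' x z a b => by rw [neg_one_mul]; exact hfm κ u κ' u' x z a b) x z a b
  rwa [neg_one_mul] at h

omit [NeZero n] in
/-- [folklore] **THE PACKED SECOND ff BLOCK IS SYMMETRIC** (`hkₛₜ : kₛₜᵀ = kₛₜ`): from the ff kernel symmetry of every pair stencil. -/
theorem packed_second_parity (hff : ∀ κ u κ' u' x z (a b : Fin (d + 1)), S₂ κ u κ' u' x z (Sum.inl a) (Sum.inl b) = S₂ κ u κ' u' z x (Sum.inl b) (Sum.inl a)) :
    (Matrix.of (periodiseF p (fTL (sortK n (arr (n * p) (fun x y a b => ∑ κ' : Fin (d + 1), ∑ κ'' : Fin (d + 1),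
        wsum (w κ') (fun u => wsum (w' κ'') (S₂ κ' u κ'')) x y a b))))))ᵀ
      = Matrix.of (periodiseF p (fTL (sortK n (arr (n * p) (fun x y a b => ∑ κ' : Fin (d + 1), ∑ κ'' : Fin (d + 1),
          wsum (w κ') (fun u => wsum (w' κ'') (S₂ κ' u κ'')) x y a b))))) := by
  refine transpose_ffHat_eq (isPeriodic₂_sortK_arr _) (fun x z a b => ?_)
  have h := arr_packed₂_inl_inl (wd := w) (ωd := w') (n * p) (ε := 1)
    (fun κ u κ' u' x z a b => by rw [one_mul]; exact hff κ u κ' u' x z a b) x z a b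
  rwa [one_mul] at h

end SecondShape

end Summit.QuantumFields.BalabanUV.Beta.D1BFx.PackedDictionaryLetters

end
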